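import Literature.MathematicalPhysics.QuantumFieldTheory.Balaban1983to89.T4HierRootedGauge
import Summits.QuantumFields.YangMills.Theorems.BalabanUVNodesN09AxialCovariance181
import Summits.QuantumFields.YangMills.Theorems.BalabanUVNodesN09HeredModFineOfThm1
import Literature.MathematicalPhysics.QuantumFieldTheory.Balaban1983to89.Node00.BackgroundSelOfRecord

/-!
# BalabanUVNodes ∕ N09 — THE RECORD's MINIMISER `U_k` READ IN THE HIERARCHICALLY ROOTED GAUGE IS HEREDITARY ON THE [B11] DOMAIN:
# `U^♮_{j+1}(Ū^{j+1}(U^♮_k V)) = U^♮_k V` EXACTLY for `U^♮_k := hierGauge k ∘ U_k` ([Balaban1987RG1] (2.3) p. 265; [Balaban1985Variational] Thm 1 p. 279, (181) p. 307)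

TRACK A (YM-PLAN §2b, node N09 of 28 = [B12] = [Balaban1987RG1] (CMP 109) Thm 3 p. 264 + Lemma 4 p. 280), WIDTH SEAT `pub-ymgap-dag-n09-w3` (g2; HUMAN RULING D-0149,
director-ym №197), FILE 4.  Key of record it serves: K1⁷ `StabilityBAtRecordR13SepCoPH` = stmt-QuantumFields-20542 (`--supports`, count-neutral helper).  A NEW importing
module over this seat's Literature FILE 3 `T4HierRootedGauge` (the nested normal form), dag-n09-w2 g2's `…N09AxialCovariance181` (`orbitRel_gaugeAct`,
`Uk_gaugeAct_orbitRel_blockLift`) dag-n09-w1 g2's `…N09HeredModFineOfThm1` (the mixed-radii one-orbit lemma + the radius transfer) and dag-n09-w4 g2's `Node00.BackgroundSelOfRecord` (`UkSel`); THEOREMS ONLY, def-free,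
sorry-free, standard axioms.  [I] = [Balaban1987RG1], [B11] = [Balaban1985Variational], [B8] = [Balaban1985RegularSpaces].

WHY.  The width seats located three properties of the selection `W ↦ U_{k+1}(W)` behind (2.3) ∕ (2.9) — (H-U) measurable, (181) block-lift covariant, HERED
«`U_{j+1}(Ū^{j+1}(U_k V)) = U_k V`» — none provable for the record's bare choice `Node00.Uk`.  dag-n09-w4 g2's `UkSel = rootGauge k ∘ f` (one-level rooted gauge) has the
first two; dag-n09-w1 g2 proved HERED for the bare choice MODULO a fine transformation and exactly under BLOCK-AXIALITY of both sides (two displayed conventions); this seat's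
FILE 1 showed no DOOR needs HERED.  THIS FILE records, for the type owner, that ONE normal form carries all three at once: reading ANY level-`k` configuration of the minimal
orbit through FILE 3's hierarchical gauge `hierGauge k` gives a selection that is measurable (`measurable_hierGauge`), (181)-covariant (§2) and HEREDITARY (§1) — the last
because `hierGauge k U` is already in every lower hierarchical gauge (`hierGauge_nested`) and [B11]'s one-orbit clause puts `U_{j+1}(Ū^{j+1}(U^♮_k V))` in the level-`(j+1)`
residual orbit of `U^♮_k V` (three residual moves: the hierarchical transporter vs. the block-constant lift of its level-`(j+1)` restriction; conjugation of the doors' `horb`;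
dag-n09-w2's `Uk_gaugeAct_orbitRel_blockLift` under solvability + uniqueness at `Ū^{j+1}(U_k V)`).  NO new definition: everything is stated for `hierGauge k (Uk … k ε V)` inline;
a record-level token `UkHier := hierGauge k ∘ f₀` would be the type owner's ∕ dag-n09-w4's `BackgroundSelOfRecord` twin — OFFERED, not filed.

WHAT THIS FILE PROVES (10 theorems).  §1 `orbitRel_blockLift_toMS_gaugeAct` (the first residual move), ★ `orbitRel_hierGauge_Uk_UkSucc` (`U_{j+1}(Ū^{j+1}(U^♮_k V))` lies in
the level-`(j+1)` residual orbit of `U^♮_k V`), ★★★ `hierGauge_Uk_hereditary` (HERED EXACT for the pair `(hierGauge k ∘ U_k^{(ε)}, hierGauge (j+1) ∘ U_{j+1}^{(ε′)})`),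
★★ `iter_hierGauge_Uk_hered` (g0 FILE 1's HERED shape: the critical configuration `M^j(U^♮_{j+1}(Ū^{j+1}U^♮_k V))` IS `Ū^j(U^♮_k V)`), ★★ `hierGauge_Uk_hereditary_of_thm1_εbg_of_reg8`
(run-level, over `domAltOfRecord`, from [B11] ×2 (`hres`, `huniq`) + the located (8)-clause `hreg8` + `0 ≤ εreg ≤ εbg`, via dag-n09-w1 g2's lemmas BY NAME).
§2 `hierGauge_Uk_gaugeAct_blockLift` ((181) for the re-gauged selection on the unique-orbit part of the solvable set), `measurable_hierGauge_comp` ((H-U) for `hierGauge k ∘ f`).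
§3 the bridge to dag-n09-w4 g2's measurable token `Node00.UkSel`: `hierGauge_UkSel_eq` (`hierGauge k ∘ UkSel = hierGauge k ∘ Uk` on the [B11] domain), `measurable_hierGauge_UkSel`
((H-U) unconditionally), ★★ `hierGauge_UkSel_hereditary` (HERED for the measurable token `hierGauge k ∘ UkSel` on the [B11] domain — measurable ∕ (181) ∕ hereditary for ONE object).

HONEST FRAMING: count-neutral kernel gauge algebra BY NAME; NOTHING of Bałaban's asserted ([B11]'s existence ∕ uniqueness ∕ restriction clauses and the (8)-membership clause are
DISPLAYED hypotheses where they appear); NO carrier of record re-pointed (HERED for the record's bare `Uk` ∕ `critCfgOfRecord` stays unprovable by design); N09 NOT discharged;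
conjunct 1 untouched; K0⁷ ∕ K1⁷ NOT closed; counts unmoved (typed 28∕28 · discharged 5∕27); one finite four-torus programme at fixed `ε = L^{−K}` per run — R4 closes the conditional
rung `BalabanLadder.UV` only; NOT ℝ⁴, NOT infinite volume, NOT OS, NOT a mass gap; the Yang–Mills mass gap (Clay) is NOT proved by any of this.
-/

noncomputable section

namespace Summit.QuantumFields.YangMills.BalabanUVNodes.N09HereditarySelection

open MeasureTheory Set
open Literature.MathematicalPhysics.QuantumFieldTheory.Balaban1983to89
open Literature.MathematicalPhysics.QuantumFieldTheory.Balaban1983to89.T4Continuum (T4Family)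
open Literature.MathematicalPhysics.QuantumFieldTheory.Balaban1983to89.Node00
open Literature.MathematicalPhysics.QuantumFieldTheory.Balaban1983to89.GaugeField (gaugeAct)
open Literature.MathematicalPhysics.QuantumFieldTheory.Balaban1983to89.B12GaugeOrbits021 (OrbitRel IsResidual gaugeAct_mul)
open Literature.MathematicalPhysics.QuantumFieldTheory.Balaban1983to89.B16Sect1Backgrounds (toMS iter_gaugeAct)
open Literature.MathematicalPhysics.QuantumFieldTheory.Balaban1983to89.B15Eq177GaugeInvariance (blockLift blockIter_embIter)
open Literature.MathematicalPhysics.QuantumFieldTheory.Balaban1983to89.B15DeterminingSets (embIter)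
open Literature.MathematicalPhysics.QuantumFieldTheory.Balaban1983to89.T4HierRootedGauge
  (hierTransporter hierGauge hierTransporter_embIter hierGauge_eq_of_orbitRel hierGauge_gaugeAct_blockLift hierGauge_eq_of_orbitRel_hierGauge measurable_hierGauge)
open N09AxialCovariance181 (orbitRel_gaugeAct Uk_gaugeAct_orbitRel_blockLift uniqueUkOrbit_gaugeAct_iff)
open N09LiftInvariance29AtRecord (ukExists_gaugeAct_iff)
open N09HeredModFineOfThm1 (orbitRel_Uk_UkSucc_iter_of_thm1_εbg_of_reg8)
open N09BackgroundRadiiTransfer (isBackground_of_le_of_mem uniqueUkOrbit_of_le_of_isBackground_mem)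
open N09BackgroundRadiiTransferRestrict (bgReg_anti_level)

variable {F : T4Family} {N : ℕ} [NeZero N]

/-- The standing range at a level `k ≤ K` of the `K`-th approximation: `k ≤ m + K`. [cite: Balaban1987RG1, (0.1) p.251 (bookkeeping)] -/
private theorem le_range_of_le {K k : ℕ} (hk : k ≤ K) : k ≤ (F.P K).m + (F.P K).K := by
  show k ≤ F.m + K
  omega

/-! ## §1. Hereditarity of the hierarchically re-gauged minimiser of record -/

/-- **FIRST RESIDUAL MOVE**: for any fine configuration `U` and any fine gauge transformation `g`, the images `U^{g}` and `U^{v̄}` — `v̄` the block-constant lift of the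
level-`i` restriction `g↾T^{(i)}` — lie in ONE residual orbit of level `i`: `g·v̄⁻¹ = 1` at the `i`-centres (`v̄(ι_i y) = g(ι_i y)`). [cite: Balaban1985Variational, (181) p.307 and (4) p.278 (bookkeeping)] -/
theorem orbitRel_blockLift_toMS_gaugeAct {K i : ℕ} (hi : i ≤ (F.P K).m + (F.P K).K) (g : GaugeTransf (F.P K) 0 (SU N)) (U : GaugeField (F.P K) 0 (SU N)) :
    OrbitRel i (gaugeAct (blockLift i (toMS g i)) U) (gaugeAct g U) := by
  refine ⟨fun x => g x * (blockLift i (toMS g i) x)⁻¹, fun y => ?_, ?_⟩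
  · show g (embIter i y) * (g (embIter i (B14.Eq22Determines.blockIter i (embIter i y))))⁻¹ = 1
    rw [blockIter_embIter i hi, mul_inv_cancel]
  · rw [← gaugeAct_mul]
    congr 1
    funext x
    show g x = g x * (blockLift i (toMS g i) x)⁻¹ * blockLift i (toMS g i) x
    rw [inv_mul_cancel_right]

/-- ★ **`U_{j+1}(Ū^{j+1}(U^♮_k V))` LIES IN THE LEVEL-`(j+1)` RESIDUAL ORBIT OF `U^♮_k V := hierGauge k (U_k V)`** (`j + 1 ≤ k ≤ K`; radii `ε` for `U_k`, `ε′` for `U_{j+1}`):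
from the doors' one-orbit clause at `V` («`U_{j+1}(Ū^{j+1}(U_k V))` lies in the residual orbit of `U_k V`», [B11] Thm 1 ∕ [I] (1.1)) and solvability + uniqueness of the
level-`(j+1)` problem at `Ū^{j+1}(U_k V)` — three residual moves: `U^♮_k V = (U_k V)^{g} ∼ (U_k V)^{v̄}` (`v̄` the block-constant lift of `g↾T^{(j+1)}`), `(U_k V)^{v̄} ∼
(U_{j+1}(Ū^{j+1}U_k V))^{v̄}` (conjugation of the one-orbit clause), `∼ U_{j+1}((Ū^{j+1}U_k V)^{g↾T^{(j+1)}})` (dag-n09-w2's `Uk_gaugeAct_orbitRel_blockLift`), and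
`(Ū^{j+1}U_k V)^{g↾T^{(j+1)}} = Ū^{j+1}(U^♮_k V)` by gauge covariance of the averages. [cite: Balaban1987RG1, (1.1) p.260 and (2.3) p.265; Balaban1985Variational, Thm 1 p.279 and (181) p.307] -/
theorem orbitRel_hierGauge_Uk_UkSucc {K k j : ℕ} (hk : k ≤ K) (hjk : j + 1 ≤ k) (ε ε' : ℝ) {V : GaugeField (F.P K) k (SU N)}
    (horbV : OrbitRel (j + 1) (Uk F N K k ε V) (Uk F N K (j + 1) ε' (Averaging.iter (avOfRecord F N K) (j + 1) (Uk F N K k ε V))))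
    (hW : UkExists F N K (j + 1) ε' (Averaging.iter (avOfRecord F N K) (j + 1) (Uk F N K k ε V)))
    (huW : UniqueUkOrbit F N K (j + 1) ε' (Averaging.iter (avOfRecord F N K) (j + 1) (Uk F N K k ε V))) :
    OrbitRel (j + 1) (hierGauge k (Uk F N K k ε V))
      (Uk F N K (j + 1) ε' (Averaging.iter (avOfRecord F N K) (j + 1) (hierGauge k (Uk F N K k ε V)))) := by
  have hj : j + 1 ≤ (F.P K).m + (F.P K).K := le_range_of_le (hjk.trans hk)
  set U₁ := Uk F N K k ε V with hU₁
  set g : GaugeTransf (F.P K) 0 (SU N) := hierTransporter k U₁ with hg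
  -- the average of the re-gauged field is the `g↾T^{(j+1)}`-transform of the average
  have havg : Averaging.iter (avOfRecord F N K) (j + 1) (hierGauge k U₁) =
      gaugeAct (toMS g (j + 1)) (Averaging.iter (avOfRecord F N K) (j + 1) U₁) :=
    iter_gaugeAct (avOfRecord F N K) g U₁ (j + 1) hj
  rw [havg]
  -- move 1: `hierGauge k U₁ = U₁^g ∼ U₁^{v̄}`
  have m1 : OrbitRel (j + 1) (hierGauge k U₁) (gaugeAct (blockLift (j + 1) (toMS g (j + 1))) U₁) :=
    (orbitRel_blockLift_toMS_gaugeAct hj g U₁).symm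
  -- move 2: conjugate the one-orbit clause by `v̄`
  have m2 : OrbitRel (j + 1) (gaugeAct (blockLift (j + 1) (toMS g (j + 1))) U₁)
      (gaugeAct (blockLift (j + 1) (toMS g (j + 1))) (Uk F N K (j + 1) ε' (Averaging.iter (avOfRecord F N K) (j + 1) U₁))) :=
    orbitRel_gaugeAct _ horbV
  -- move 3: dag-n09-w2's (181) modulo the residual group for the bare choice
  have m3 := Uk_gaugeAct_orbitRel_blockLift (F := F) (N := N) hj ε' (toMS g (j + 1)) hW huW
  exact (m1.trans m2).trans m3

/-- ★★★ **HERED, EXACT, FOR THE HIERARCHICALLY RE-GAUGED SELECTION**: with `U^♮_k V := hierGauge k (U_k^{(ε)} V)` and `W₀ := Ū^{j+1}(U^♮_k V)` (`j + 1 ≤ k ≤ K`),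
`hierGauge (j+1) (U_{j+1}^{(ε′)}(W₀)) = U^♮_k V` — the level-`(j+1)` hierarchically re-gauged minimiser over the `(j+1)`-average of the level-`k` one IS the level-`k` one
([I] (2.3) «related to the minimal configuration U_{k+1}(W) in the axial gauge»; [B8] (1.19)–(1.20)), from [B11]'s one-orbit clause at `V` + solvability and uniqueness at
`Ū^{j+1}(U_k V)` (§1) + FILE 3's nestedness.  Radii arbitrary; nothing of Bałaban asserted. [cite: Balaban1987RG1, (2.3) p.265 and (1.1) p.260; Balaban1985Variational, Thm 1 (9)–(10) p.279; Balaban1985RegularSpaces, (1.19) p.80] -/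
theorem hierGauge_Uk_hereditary {K k j : ℕ} (hk : k ≤ K) (hjk : j + 1 ≤ k) (ε ε' : ℝ) {V : GaugeField (F.P K) k (SU N)}
    (horbV : OrbitRel (j + 1) (Uk F N K k ε V) (Uk F N K (j + 1) ε' (Averaging.iter (avOfRecord F N K) (j + 1) (Uk F N K k ε V))))
    (hW : UkExists F N K (j + 1) ε' (Averaging.iter (avOfRecord F N K) (j + 1) (Uk F N K k ε V)))
    (huW : UniqueUkOrbit F N K (j + 1) ε' (Averaging.iter (avOfRecord F N K) (j + 1) (Uk F N K k ε V))) :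
    hierGauge (j + 1) (Uk F N K (j + 1) ε' (Averaging.iter (avOfRecord F N K) (j + 1) (hierGauge k (Uk F N K k ε V)))) =
      hierGauge k (Uk F N K k ε V) :=
  hierGauge_eq_of_orbitRel_hierGauge hjk (le_range_of_le hk) (orbitRel_hierGauge_Uk_UkSucc hk hjk ε ε' horbV hW huW)

/-- ★★ **g0 FILE 1's HERED SHAPE FOR THE RE-GAUGED PAIR**: the critical configuration (2.3) built from the hierarchically re-gauged selections,
`M^j(U^♮_{j+1}(Ū^{j+1}(U^♮_k V)))`, IS `Ū^j(U^♮_k V)` (apply `M^j` to `hierGauge_Uk_hereditary`). [cite: Balaban1987RG1, (2.3) p.265; Balaban1985Variational, Thm 1 (9)–(10) p.279] -/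
theorem iter_hierGauge_Uk_hered {K k j : ℕ} (hk : k ≤ K) (hjk : j + 1 ≤ k) (ε ε' : ℝ) {V : GaugeField (F.P K) k (SU N)}
    (horbV : OrbitRel (j + 1) (Uk F N K k ε V) (Uk F N K (j + 1) ε' (Averaging.iter (avOfRecord F N K) (j + 1) (Uk F N K k ε V))))
    (hW : UkExists F N K (j + 1) ε' (Averaging.iter (avOfRecord F N K) (j + 1) (Uk F N K k ε V)))
    (huW : UniqueUkOrbit F N K (j + 1) ε' (Averaging.iter (avOfRecord F N K) (j + 1) (Uk F N K k ε V))) :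
    Averaging.iter (avOfRecord F N K) j
        (hierGauge (j + 1) (Uk F N K (j + 1) ε' (Averaging.iter (avOfRecord F N K) (j + 1) (hierGauge k (Uk F N K k ε V))))) =
      Averaging.iter (avOfRecord F N K) j (hierGauge k (Uk F N K k ε V)) := by
  rw [hierGauge_Uk_hereditary hk hjk ε ε' horbV hW huW]

/-- ★★ **RUN-LEVEL HERED FOR THE RE-GAUGED SELECTION AT THE RECORD's TWO RADII** (`U_k` at `εbg`, `U_{j+1}` at `ν.εreg ≤ εbg`, over the small-field domains
`domAltOfRecord ν K k`): from [B11]'s restriction `hres` and intermediate uniqueness `huniq` at `εbg` + the located (8)-membership clause `hreg8` + `0 ≤ εreg ≤ εbg`, the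
one-orbit clause, solvability and uniqueness at `Ū^{j+1}(U_k V)` are dag-n09-w1 g2's theorems (`orbitRel_Uk_UkSucc_iter_of_thm1_εbg_of_reg8`, `isBackground_of_le_of_mem`,
`uniqueUkOrbit_of_le_of_isBackground_mem`, `bgReg_anti_level`, BY NAME), whence `hierGauge (j+1) (U_{j+1}^{(εreg)}(Ū^{j+1}U^♮_k V)) = U^♮_k V` for every `V ∈ domAlt_k`,
`j + 1 ≤ k ≤ K`.  [B11]'s clauses DISPLAYED; nothing asserted. [cite: Balaban1987RG1, (2.3) p.265 and (1.1)–(1.2) p.260; Balaban1985Variational, Thm 1 (6), (8)–(10) p.279 and (181) p.307] -/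
theorem hierGauge_Uk_hereditary_of_thm1_εbg_of_reg8 (ν : Stage7Numerics) (εbg : ℝ) (K : ℕ)
    (hres : ∀ k, k ≤ K → HRestrict F N εbg K k (domAltOfRecord F N ν K k))
    (huniq : ∀ k, k ≤ K → ∀ V ∈ domAltOfRecord F N ν K k, ∀ j < k,
      UniqueUkOrbit F N K (j + 1) εbg (Averaging.iter (avOfRecord F N K) (j + 1) (Uk F N K k εbg V)))
    (hreg8 : ∀ k, k ≤ K → ∀ V ∈ domAltOfRecord F N ν K k, Uk F N K k εbg V ∈ bgReg F N K k ν.εreg) (hle : ν.εreg ≤ εbg) (hεreg : 0 ≤ ν.εreg) :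
    ∀ k, k ≤ K → ∀ V ∈ domAltOfRecord F N ν K k, ∀ j < k,
      hierGauge (j + 1) (Uk F N K (j + 1) ν.εreg (Averaging.iter (avOfRecord F N K) (j + 1) (hierGauge k (Uk F N K k εbg V)))) =
        hierGauge k (Uk F N K k εbg V) := by
  intro k hk V hV j hj
  have hB := hres k hk V hV j hj
  have hmem : Uk F N K k εbg V ∈ bgReg F N K (j + 1) ν.εreg := bgReg_anti_level (by omega) hεreg (hreg8 k hk V hV)
  have hBε := isBackground_of_le_of_mem hle hB hmem
  exact hierGauge_Uk_hereditary hk (Nat.succ_le_of_lt hj) εbg ν.εreg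
    (orbitRel_Uk_UkSucc_iter_of_thm1_εbg_of_reg8 ν εbg K hres huniq hreg8 hle hεreg k hk V hV j hj) ⟨_, hBε⟩
    (uniqueUkOrbit_of_le_of_isBackground_mem hle hB hmem (huniq k hk V hV j hj))

/-! ## §2. (181) and (H-U) for the hierarchically re-gauged selection -/

/-- **(181) FOR THE RE-GAUGED SELECTION** on the unique-orbit part of the solvable set (level `k + 1 ≤ m + K`): `U^♮_{k+1}(W^v) = (U^♮_{k+1}(W))^{v∘B^{k+1}}` — dag-n09-w2's
(181) modulo the residual group for the bare choice (`Uk_gaugeAct_orbitRel_blockLift`) + FILE 3's orbit-constancy and block-lift equivariance of `hierGauge`.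
[cite: Balaban1985Variational, (181) p.307 and Thm 1 p.279; Balaban1987RG1, (0.21) p.256] -/
theorem hierGauge_Uk_gaugeAct_blockLift {K k : ℕ} (hk : k + 1 ≤ (F.P K).m + (F.P K).K) (ε : ℝ) (v : GaugeTransf (F.P K) (k + 1) (SU N))
    {W : GaugeField (F.P K) (k + 1) (SU N)} (hW : UkExists F N K (k + 1) ε W) (huW : UniqueUkOrbit F N K (k + 1) ε W) :
    hierGauge (k + 1) (Uk F N K (k + 1) ε (gaugeAct v W)) = gaugeAct (blockLift (k + 1) v) (hierGauge (k + 1) (Uk F N K (k + 1) ε W)) := by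
  rw [hierGauge_eq_of_orbitRel (Uk_gaugeAct_orbitRel_blockLift hk ε v hW huW), hierGauge_gaugeAct_blockLift hk]

/-- **(H-U) FOR THE RE-GAUGED SELECTION**: `hierGauge k ∘ f` is measurable for every measurable selector `f` (FILE 3 `measurable_hierGauge`; dag-n09-w4 g2's
`exists_measurable_ukSelector` ∕ `Node00.exists_measurable_ukSelector` supply such `f` with `Uk`'s contract). [cite: Balaban1987RG1, (0.21) p.256 (bookkeeping)] -/
theorem measurable_hierGauge_comp {K j k : ℕ} {f : GaugeField (F.P K) j (SU N) → GaugeField (F.P K) 0 (SU N)} (hf : Measurable f) :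
    Measurable fun W => hierGauge k (f W) :=
  (measurable_hierGauge k).comp hf

/-! ## §3. The bridge to dag-n09-w4 g2's token `Node00.UkSel`: `hierGauge k ∘ UkSel` is MEASURABLE EVERYWHERE and equals `hierGauge k ∘ Uk` on the [B11] domain -/

/-- **`hierGauge k ∘ UkSel = hierGauge k ∘ Uk` ON THE [B11] DOMAIN**: the offer `UkSel` lies in the minimal residual orbit of the bare choice (`orbitRel_Uk_UkSel`), and the
hierarchical gauge is constant on residual orbits — so every statement of §1–§2 about `hierGauge k (Uk … V)` is a statement about `hierGauge k (UkSel … V)` there.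
[cite: Balaban1987RG1, (0.21) p.256; Balaban1985Variational, (19) p.281] -/
theorem hierGauge_UkSel_eq {K k : ℕ} (hk : k ≤ (F.P K).m + (F.P K).K) (ε : ℝ) {V : GaugeField (F.P K) k (SU N)} (h : UkExists F N K k ε V)
    (hu : UniqueUkOrbit F N K k ε V) : hierGauge k (UkSel F N K k ε V) = hierGauge k (Uk F N K k ε V) :=
  hierGauge_eq_of_orbitRel (orbitRel_Uk_UkSel hk h hu)

/-- **(H-U) UNCONDITIONALLY for `hierGauge k ∘ UkSel`** (dag-n09-w4 g2's `measurable_UkSel` + FILE 3 `measurable_hierGauge`): the hierarchically re-gauged offer is a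
MEASURABLE selection — with (181) (§2) and HERED (§1, through `hierGauge_UkSel_eq`) on the [B11] domain. [cite: Balaban1987RG1, (0.21) p.256 (bookkeeping)] -/
theorem measurable_hierGauge_UkSel (K k : ℕ) (ε : ℝ) : Measurable fun V => hierGauge k (UkSel F N K k ε V) :=
  (measurable_hierGauge k).comp (measurable_UkSel K k ε)

/-- ★★ **HERED FOR THE MEASURABLE TOKEN**: with `U^♯_k V := hierGauge k (UkSel … k ε V)` (measurable in `V`), on the [B11] domain (`V` solvable with unique orbit at
`(k, ε)`; the one-orbit clause at `V`; solvable + unique at `Ū^{j+1}(U_k V)`), `hierGauge (j+1) (UkSel … (j+1) ε′ (Ū^{j+1} U^♯_k V)) = U^♯_k V` — the three selection properties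
(measurable ∕ (181) ∕ hereditary) for ONE object. [cite: Balaban1987RG1, (2.3) p.265 and (1.1) p.260; Balaban1985Variational, Thm 1 (9)–(10) p.279 and (19) p.281] -/
theorem hierGauge_UkSel_hereditary {K k j : ℕ} (hk : k ≤ K) (hjk : j + 1 ≤ k) (ε ε' : ℝ) {V : GaugeField (F.P K) k (SU N)}
    (hV : UkExists F N K k ε V) (huV : UniqueUkOrbit F N K k ε V)
    (horbV : OrbitRel (j + 1) (Uk F N K k ε V) (Uk F N K (j + 1) ε' (Averaging.iter (avOfRecord F N K) (j + 1) (Uk F N K k ε V))))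
    (hW : UkExists F N K (j + 1) ε' (Averaging.iter (avOfRecord F N K) (j + 1) (Uk F N K k ε V)))
    (huW : UniqueUkOrbit F N K (j + 1) ε' (Averaging.iter (avOfRecord F N K) (j + 1) (Uk F N K k ε V))) :
    hierGauge (j + 1) (UkSel F N K (j + 1) ε' (Averaging.iter (avOfRecord F N K) (j + 1) (hierGauge k (UkSel F N K k ε V)))) =
      hierGauge k (UkSel F N K k ε V) := by
  have hj : j + 1 ≤ (F.P K).m + (F.P K).K := le_range_of_le (hjk.trans hk)
  rw [hierGauge_UkSel_eq (le_range_of_le hk) ε hV huV]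
  -- the level-`(j+1)` problem at `Ū^{j+1}(U^♮_k V)` is the `g↾T^{(j+1)}`-transform of the one at `Ū^{j+1}(U_k V)`: solvable and unique there too
  have havg : Averaging.iter (avOfRecord F N K) (j + 1) (hierGauge k (Uk F N K k ε V)) =
      gaugeAct (toMS (hierTransporter k (Uk F N K k ε V)) (j + 1)) (Averaging.iter (avOfRecord F N K) (j + 1) (Uk F N K k ε V)) :=
    iter_gaugeAct (avOfRecord F N K) _ _ (j + 1) hj
  have hW' : UkExists F N K (j + 1) ε' (Averaging.iter (avOfRecord F N K) (j + 1) (hierGauge k (Uk F N K k ε V))) := by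
    rw [havg]; exact (ukExists_gaugeAct_iff hj ε' _ _).2 hW
  have huW' : UniqueUkOrbit F N K (j + 1) ε' (Averaging.iter (avOfRecord F N K) (j + 1) (hierGauge k (Uk F N K k ε V))) := by
    rw [havg]; exact (uniqueUkOrbit_gaugeAct_iff hj ε' _ _).2 huW
  rw [hierGauge_UkSel_eq hj ε' hW' huW']
  exact hierGauge_Uk_hereditary hk hjk ε ε' horbV hW huW

end Summit.QuantumFields.YangMills.BalabanUVNodes.N09HereditarySelection

end
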